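import Summits.Ventures.HSemireg.SiegelComponentChartFromFacts
import HarnessLib

/-!
# Venture HSemireg — the transfer chain for a GENERAL family from BASE-CHART DATA: semiregular at ONE point
# of a smooth irreducible algebraic base chart ⟹ algebraic on the whole swept set

HONEST FRAMING. Assembly file of the computation cell `pub-hsemireg` (theory seat 2); theorems only, no definition,
no named fact; nothing here says that HC / HC_CM / HC_AV holds. `ComponentTransfer.lean` (theory seat 3) proves
«semiregular at one point ⟹ algebraic on the swept set» for a chart `(T, f : 𝒳 ⟶ T, W)` that CARRIES THE CLASS
GLOBALLY (`SweepsClasses g f W A`, a raw hypothesis); `SiegelComponentChartFromFacts.lean` (theory seat 2) shows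
that such a chart comes from BASE-CHART data `(T, ρ : T ⟶ M, τ : T(ℂ) → FiberClass g (2p))` — a smooth irreducible
quasi-projective `T` mapping to the base with a continuous lift to the étalé space — by base change and Deligne's
théorème de la partie fixe (`exists_sweepingClass_of_baseChart`, granted the tree's named fact
`deligne_globalInvariantCycles`). This file composes the two for an ARBITRARY smooth projective family
`g : 𝒴 ⟶ M` (`𝒴`, `M` quasi-projective, `M` smooth) — the form a Shimura-type family other than `𝒜_{g,δ,N}`
(e.g. a Weil-type family over a unitary Shimura variety) or ONE IRREDUCIBLE COMPONENT of a reducible Hodge-locus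
component of a general family would use (theory seat 2, TH2-CHAIN-ARROWS §9.3: for a general family a connected
component of the locus of Hodge classes may be reducible, and the conclusion is on the swept set `range τ` only):

* `forall_mem_algebraicClasses_of_baseChart` — inputs BY NAME `deligne_globalInvariantCycles` (Hodge II 4.1.1) and
  `BlochSemiregularSpread n p` (Bloch 1972 (7.4) / Buchweitz–Flenner 2003 5.2); data: the family, the base chart
  `(T, ρ, τ)` with Hodge values, and at ONE chart point `u₀` an integral Bloch-semiregular lci `Z ↪ 𝒴_{(τ u₀).pt}` of
  codimension `p` supporting the class `(τ u₀).cls`; conclusion: `(τ u).cls` is algebraic on `𝒴_{(τ u).pt}` for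
  EVERY `u ∈ T(ℂ)`.
* `forall_mem_algebraicClasses_of_baseChart_of_smul_add` — Bloch's Remark (7.5) form: `Λ` a global class on `𝒴`
  fibrewise rational `(p,p)` and fibrewise algebraic (a power of a relative polarisation), the lci supporting
  `a·(τ u₀).cls + b·Λ|` with `a ≠ 0` (the non-vacuous form for primitive classes such as Weil classes).

References: [Bloch1972Semiregularity] (7.4), (7.5) p. 65; [BuchweitzFlenner2003] Thm. 5.2; [DeligneHodgeII1971]
Thm. 4.1.1; [Voisin2007HodgeLoci] §3; [CattaniDeligneKaplan1995JAMS] Thm. 1.1; [MoonenOort2013Torelli] §3.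
-/

noncomputable section

open CategoryTheory AlgebraicGeometry Set
open Literature.AlgebraicGeometry.Motives Literature.AlgebraicGeometry.HodgeTheory

namespace Summit.Ventures.HSemireg

local notation3 (prettyPrint := false) "Res[" f ", " s ", " k ", " A "]" =>
  complexBetti.map (Literature.AlgebraicGeometry.Motives.fiberι f s) k A

section General

variable {𝒴 M T : SchemeOver ℂ} (g : 𝒴 ⟶ M) (ρ : T ⟶ M) {n p : ℕ}

/-- The global class of `exists_sweepingClass_of_baseChart` makes the base-changed family SWEEP the set `range τ`
(th-3's `SweepsClasses`), with the canonical fibre isomorphisms `(𝒴 ×_M T)_u ≅ 𝒴_{ρ u}`. [folklore] -/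
theorem sweepsClasses_range_of_baseChart {W : complexBetti (familyPullback g ρ) (2 * p)}
    {τ : ComplexPoints T → FiberClass g (2 * p)}
    (hWτ : ∀ u : ComplexPoints T,
      τ u = FiberClass.baseChange g ρ (2 * p) (globalSection (familyPullback.snd g ρ) (2 * p) W u)) :
    SweepsClasses g (familyPullback.snd g ρ) W (Set.range τ) := by
  rintro x ⟨u, rfl⟩
  rw [hWτ u]
  refine ⟨u, fiberOverFamilyPullbackIso g ρ u, ?_⟩
  change complexBetti.map (fiberOverFamilyPullbackIso g ρ u).hom (2 * p)
      (complexBetti.map (fiberOverFamilyPullbackIso g ρ u).inv (2 * p)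
        (Res[familyPullback.snd g ρ, u, 2 * p, W])) = Res[familyPullback.snd g ρ, u, 2 * p, W]
  rw [(fiberOverFamilyPullbackIso g ρ u).complexBetti_map_hom_map_inv]

/-- **Semiregular at ONE point of a base chart ⟹ algebraic on the whole swept set (general families, plain form).**
`g : 𝒴 ⟶ M` a smooth projective family of relative dimension `n`, `𝒴`, `M` quasi-projective, `M` smooth; `(T, ρ, τ)`
a base chart: `T` smooth irreducible quasi-projective, `ρ : T ⟶ M`, `τ : T(ℂ) → FiberClass g (2p)` continuous over
`ρ(ℂ)` with every value a Hodge class (e.g. `T` the connected Shimura variety uniformising a special subvariety and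
`τ` the tautological section); at ONE `u₀` an integral Bloch-semiregular lci `Z ↪ 𝒴_{(τ u₀).pt}` of codimension `p`
supporting `(τ u₀).cls`. THEN, granted `deligne_globalInvariantCycles` and `BlochSemiregularSpread n p`, `(τ u).cls` is
algebraic for EVERY `u`. Proof: `exists_sweepingClass_of_baseChart` (global class `W` on `𝒴 ×_M T`) +
`forall_mem_algebraicClasses_of_sweepsClasses` (theory seat 3). [cite: Bloch1972Semiregularity, Thm. (7.4), p. 65]
[cite: BuchweitzFlenner2003, Thm. 5.2] [cite: DeligneHodgeII1971, Théorème 4.1.1]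
[cite: Voisin2007HodgeLoci, §3, proof of Prop. 0.7] -/
theorem forall_mem_algebraicClasses_of_baseChart (hGIC : deligne_globalInvariantCycles)
    (hB : BlochSemiregularSpread n p) (hg : IsSmoothProjectiveFamily g n) (h𝒴 : IsQuasiProjectiveOver 𝒴)
    (hM : IsQuasiProjectiveOver M) [_root_.AlgebraicGeometry.Smooth M.hom] (hT : IsQuasiProjectiveOver T)
    [_root_.AlgebraicGeometry.Smooth T.hom] [IrreducibleSpace T.left]
    {τ : ComplexPoints T → FiberClass g (2 * p)} (hτ : Continuous τ)
    (hτpt : ∀ u, (τ u).pt = AlgPoints.map ρ u) (hτH : ∀ u, τ u ∈ locusOfHodgeClasses g n p)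
    (u₀ : ComplexPoints T) {Z : Scheme.{0}} (i : Z ⟶ (fiberOver g (τ u₀).pt).left) (hi : IsClosedImmersion i)
    (hreg : IsRegularImmersionOfCodim i p) (hZ : AlgebraicGeometry.IsIntegral Z)
    (hcodim : ∀ z ∈ Set.range i.base, (p : ℕ∞) ≤ Order.coheight z) (hsr : IsBlochSemiregular i n p)
    (hsupp : (τ u₀).cls ∈ classesSupportedOn (fiberOver g (τ u₀).pt) (Set.range i.base) (2 * p)) :
    ∀ u : ComplexPoints T, (τ u).cls ∈ algebraicClasses (fiberOver g (τ u).pt) p := by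
  haveI : IsSeparated M.hom := isSeparated_hom_of_isQuasiProjectiveOver hM
  obtain ⟨W, hWH, hWτ⟩ := exists_sweepingClass_of_baseChart g ρ hGIC hg h𝒴 hM hT hτ hτpt hτH u₀
  have hsweep := sweepsClasses_range_of_baseChart g ρ hWτ
  have hall := forall_mem_algebraicClasses_of_sweepsClasses hB (hg.familyPullback_snd ρ)
    (isQuasiProjectiveOver_familyPullback_of_isSeparated g ρ h𝒴 hT) hT ‹_› hWH hsweep
    (Set.mem_range_self u₀) i hi hreg hZ hcodim hsr hsupp
  exact fun u => hall (τ u) (Set.mem_range_self u)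

/-- **Semiregular at ONE point of a base chart ⟹ algebraic on the whole swept set (general families, Bloch's Remark
(7.5) form `a·α + b·Λ|`).** As `forall_mem_algebraicClasses_of_baseChart`, with a global class `Λ` on `𝒴` fibrewise
rational `(p,p)` AND fibrewise algebraic, and the lci at `u₀` supporting `a·(τ u₀).cls + b·Λ|_{𝒴_{(τ u₀).pt}}`,
`a, b ∈ ℚ`, `a ≠ 0`. Proof: with `W` from `exists_sweepingClass_of_baseChart` and `L := pr^*Λ` on `𝒴 ×_M T`, apply the
global form of `BlochSemiregularSpread` to `a·W + b·L` along the model isomorphism `𝒴_{(τ u₀).pt} ≅ (𝒴 ×_M T)_{u₀}`,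
subtract the algebraic `b·L|`, divide by `a`, sweep. [cite: Bloch1972Semiregularity, Thm. (7.4) and Remark (7.5), p. 65]
[cite: BuchweitzFlenner2003, Thm. 5.2] [cite: DeligneHodgeII1971, Théorème 4.1.1] -/
theorem forall_mem_algebraicClasses_of_baseChart_of_smul_add (hGIC : deligne_globalInvariantCycles)
    (hB : BlochSemiregularSpread n p) (hg : IsSmoothProjectiveFamily g n) (h𝒴 : IsQuasiProjectiveOver 𝒴)
    (hM : IsQuasiProjectiveOver M) [_root_.AlgebraicGeometry.Smooth M.hom] (hT : IsQuasiProjectiveOver T)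
    [_root_.AlgebraicGeometry.Smooth T.hom] [IrreducibleSpace T.left]
    {τ : ComplexPoints T → FiberClass g (2 * p)} (hτ : Continuous τ)
    (hτpt : ∀ u, (τ u).pt = AlgPoints.map ρ u) (hτH : ∀ u, τ u ∈ locusOfHodgeClasses g n p)
    (Λ : complexBetti 𝒴 (2 * p))
    (hΛ : ∀ s : ComplexPoints M, IsRationalClass (Res[g, s, 2 * p, Λ]) ∧
      IsOfHodgeType n (fiberOver g s) (2 * p) p p (Res[g, s, 2 * p, Λ]))
    (hΛalg : ∀ s : ComplexPoints M, Res[g, s, 2 * p, Λ] ∈ algebraicClasses (fiberOver g s) p)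
    (u₀ : ComplexPoints T) (a b : ℚ) (ha : a ≠ 0)
    {Z : Scheme.{0}} (i : Z ⟶ (fiberOver g (τ u₀).pt).left) (hi : IsClosedImmersion i)
    (hreg : IsRegularImmersionOfCodim i p) (hZ : AlgebraicGeometry.IsIntegral Z)
    (hcodim : ∀ z ∈ Set.range i.base, (p : ℕ∞) ≤ Order.coheight z) (hsr : IsBlochSemiregular i n p)
    (hsupp : (a : ℂ) • (τ u₀).cls + (b : ℂ) • Res[g, (τ u₀).pt, 2 * p, Λ] ∈
      classesSupportedOn (fiberOver g (τ u₀).pt) (Set.range i.base) (2 * p)) :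
    ∀ u : ComplexPoints T, (τ u).cls ∈ algebraicClasses (fiberOver g (τ u).pt) p := by
  haveI : IsSeparated M.hom := isSeparated_hom_of_isQuasiProjectiveOver hM
  obtain ⟨W, hWH, hWτ⟩ := exists_sweepingClass_of_baseChart g ρ hGIC hg h𝒴 hM hT hτ hτpt hτH u₀
  set f := familyPullback.snd g ρ with hfdef
  have hf : IsSmoothProjectiveFamily f n := hg.familyPullback_snd ρ
  have h𝒳 : IsQuasiProjectiveOver (familyPullback g ρ) :=
    isQuasiProjectiveOver_familyPullback_of_isSeparated g ρ h𝒴 hT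
  have hsweep := sweepsClasses_range_of_baseChart g ρ hWτ
  -- the pulled-back class `L = pr^*Λ` and its fibrewise properties
  set L : complexBetti (familyPullback g ρ) (2 * p) := complexBetti.map (familyPullback.fst g ρ) (2 * p) Λ
    with hLdef
  have hLres : ∀ u : ComplexPoints T, Res[f, u, 2 * p, L] =
      complexBetti.map (fiberOverFamilyPullbackIso g ρ u).hom (2 * p) (Res[g, AlgPoints.map ρ u, 2 * p, Λ]) :=
    fun u => map_fiberι_familyPullback g ρ (2 * p) Λ u
  have hLfib : ∀ u : ComplexPoints T, (IsRationalClass (Res[f, u, 2 * p, L]) ∧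
      IsOfHodgeType n (fiberOver f u) (2 * p) p p (Res[f, u, 2 * p, L])) ∧
      Res[f, u, 2 * p, L] ∈ algebraicClasses (fiberOver f u) p := fun u => by
    rw [hLres u]
    exact ⟨⟨(isRationalClass_map_iff_of_iso _).2 (hΛ _).1, (isOfHodgeType_map_iff_of_iso _).2 (hΛ _).2⟩,
      (mem_algebraicClasses_map_iff_of_iso _).2 (hΛalg _)⟩
  -- generalise the seed point `x₀ := τ u₀` and identify it with the transfer of the global section of `W`
  generalize hx : τ u₀ = x₀ at i hsupp
  obtain rfl : x₀ = FiberClass.baseChange g ρ (2 * p) (globalSection f (2 * p) W u₀) := hx.symm.trans (hWτ u₀)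
  -- the combined global class `V = a·W + b·L` on the chart and its fibrewise properties
  have hVres : ∀ u : ComplexPoints T, Res[f, u, 2 * p, (a : ℂ) • W + (b : ℂ) • L] =
      (a : ℂ) • Res[f, u, 2 * p, W] + (b : ℂ) • Res[f, u, 2 * p, L] := fun u => by
    simp only [map_add, map_smul]
  have hVhodge : ∀ u : ComplexPoints T, IsRationalClass (Res[f, u, 2 * p, (a : ℂ) • W + (b : ℂ) • L]) ∧
      IsOfHodgeType n (fiberOver f u) (2 * p) p p (Res[f, u, 2 * p, (a : ℂ) • W + (b : ℂ) • L]) := fun u => by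
    rw [hVres u]
    exact ⟨((hWH u).1.smul a).add ((hLfib u).1.1.smul b),
      ((hWH u).2.smul (a : ℂ)).add (hf.isSmoothProjective u) ((hLfib u).1.2.smul (b : ℂ))⟩
  -- the model isomorphism `e : 𝒴_{ρ u₀} ≅ (𝒴 ×_M T)_{u₀}` carries `V|_{u₀}` to the supported class
  set e : fiberOver g (AlgPoints.map ρ u₀) ≅ fiberOver f u₀ := (fiberOverFamilyPullbackIso g ρ u₀).symm with hedef
  have hVx : complexBetti.map e.hom (2 * p) (Res[f, u₀, 2 * p, (a : ℂ) • W + (b : ℂ) • L]) =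
      (a : ℂ) • (FiberClass.baseChange g ρ (2 * p) (globalSection f (2 * p) W u₀)).cls +
        (b : ℂ) • Res[g, (FiberClass.baseChange g ρ (2 * p) (globalSection f (2 * p) W u₀)).pt, 2 * p, Λ] := by
    change complexBetti.map (fiberOverFamilyPullbackIso g ρ u₀).inv (2 * p)
        (Res[f, u₀, 2 * p, (a : ℂ) • W + (b : ℂ) • L]) =
      (a : ℂ) • complexBetti.map (fiberOverFamilyPullbackIso g ρ u₀).inv (2 * p) (Res[f, u₀, 2 * p, W]) +
        (b : ℂ) • Res[g, AlgPoints.map ρ u₀, 2 * p, Λ]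
    rw [hVres u₀, map_add, map_smul, map_smul, hLres u₀,
      (fiberOverFamilyPullbackIso g ρ u₀).complexBetti_map_inv_map_hom]
  -- Bloch's theorem, global form, along the chart: `V` is algebraic on every fibre of the chart
  have hVall : ∀ u : ComplexPoints T,
      Res[f, u, 2 * p, (a : ℂ) • W + (b : ℂ) • L] ∈ algebraicClasses (fiberOver f u) p :=
    hB.forall_mem_algebraicClasses charlesSchnell_algebraicityLocus_iUnion_closed_holds _ Z i _ f u₀ e
      ((a : ℂ) • W + (b : ℂ) • L) hi hreg hZ hcodim hsr hsupp hf h𝒳 hT ‹_› hVhodge hVx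
  -- subtract the algebraic `b·L|` and divide by `a`
  have ha' : (a : ℂ) ≠ 0 := by exact_mod_cast ha
  have hWalg : ∀ u : ComplexPoints T, Res[f, u, 2 * p, W] ∈ algebraicClasses (fiberOver f u) p := by
    intro u
    have h1 : (a : ℂ) • Res[f, u, 2 * p, W] ∈ algebraicClasses (fiberOver f u) p := by
      have := Submodule.sub_mem _ (hVall u) (Submodule.smul_mem _ (b : ℂ) (hLfib u).2)
      rwa [hVres u, add_sub_cancel_right] at this
    have h2 := Submodule.smul_mem _ (a : ℂ)⁻¹ h1
    rwa [smul_smul, inv_mul_cancel₀ ha', one_smul] at h2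
  exact fun u => hsweep.mem_algebraicClasses hWalg (Set.mem_range_self u)

end General

end Summit.Ventures.HSemireg

end
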